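import Summits.QuantumFields.BalabanUV.T4Continuum.Spine.NE1p.TiltedMeanOneParameter
import Literature.MathematicalPhysics.QuantumFieldTheory.Balaban1983to89.BlockAveragingExpMeanLog

/-!
# T⁴ programme, spine estimate NE1′ (node O3b/H2) — the one-parameter linearity FOR THE PRINTED PRESCRIPTION (0.4): `eml` =
# `exp[i Σ_i |I|⁻¹ (1/i) log W_i]` averages one-parameter configurations linearly in the exponent (no diagonal curvature)

Cell `pub-balaban-gaps` (YM blitz Y1, track G2), seat `ne1` gen 7 (prover-pub-balaban-gaps-ne1-g7-0); sequel of `TiltedMeanOneParameter`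
(p358197 ✓).  ADDITIVE — imports that sibling and the pv26 lineage's `Literature/…/BlockAveragingExpMeanLog` (its `ExpMeanLog.eml`, the
matrix form of the headline's printed averaging `expMeanLogSU` on the small-field guard, `coe_ESU_of_small` — consumed BY NAME, nothing
edited) ONLY.

WHY.  [GAPSNE7-G8-INTENT-1] (ne7 gen 8, cc ne1) locates that the headline `T4ContinuumYM4Torus.continuumYM4_torus_of_BetaPertH` is pinned to
`D.IsPrintedAveraged` — the B12 (0.4)∕(0.10)–(0.12) prescription `expMeanLogSU` on SU(N) —, not to B7 (15)'s `avgB7`.  The sibling's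
one-parameter lemma is stated for the b07 carrier `barAvg`; since `ExpMeanLog.eml W = barAvg univ (|I|⁻¹) W` DEFINITIONALLY, the
statement for the printed prescription is a corollary, recorded here so that NE1.md R46 (a)'s structural reading («diagonal curvature zero
on one-parameter slots») is kernel for the averaging OF RECORD: `eml_oneParameter` (one-parameter inputs `W_i = exp(s_i·C)`,
`‖s_i·C‖ < ln 2` ⇒ `eml W = exp((Σ_i |I|⁻¹ s_i)·C)`), `eml_oneParameter_scale` (NO `a²` term).  The SU(N)-packaged `expMeanLogSU.E`
agrees with `eml` on the guard `‖W_i − 1‖ < δ_N` (`ExpMeanLog.coe_ESU_of_small`); membership of `exp(s·C)` in SU(N) for skew-Hermitian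
traceless `C` is the pv26 lineage's `eml_mem_specialUnitaryGroup` territory and not restated.

HONEST FRAMING.  [folklore] corollary by name; nothing of Bałaban's beyond the SHAPE of (0.4) is used; no slot or background of his run is
constructed; NE1′ NOT proved; spine 0∕9; (B) 0∕13; one fixed finite T⁴ — NOT ℝ⁴, NOT infinite volume, NOT a mass gap, NOT Clay.  0 sorry.
-/

noncomputable section

open NormedSpace Finset
open scoped BigOperators

namespace Summit.QuantumFields.BalabanUV.T4Continuum.NE1p.TiltedMeanOneParameter

open Literature.MathematicalPhysics.QuantumFieldTheory.Balaban1983to89.ExpMeanLog (eml)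

variable {𝔸 : Type*} [NormedRing 𝔸] [NormedAlgebra ℂ 𝔸] [CompleteSpace 𝔸] {ι : Type*} [Fintype ι]

/-- **THE PRINTED PRESCRIPTION (0.4) AVERAGES ONE-PARAMETER CONFIGURATIONS LINEARLY IN THE EXPONENT.**  For `W_i = exp(s_i·C)` with
`‖s_i·C‖ < ln 2`: `eml W = exp((Σ_i |I|⁻¹·s_i)·C)` — the exp-mean-log of [Balaban1987RG1] (0.4) p. 253 (`ExpMeanLog.eml`, = the b07
carrier `barAvg` with uniform weights, definitionally) stays in the subgroup with the MEAN exponent. [folklore] -/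
theorem eml_oneParameter (C : 𝔸) (s : ι → ℝ) (hs : ∀ i, ‖s i • C‖ < Real.log 2) :
    eml (fun i => exp (s i • C)) = exp ((∑ i, ((Fintype.card ι : ℝ))⁻¹ * s i) • C) :=
  barAvg_oneParameter Finset.univ (fun _ => ((Fintype.card ι : ℝ))⁻¹) C s fun i _ => hs i

/-- **NO DIAGONAL CURVATURE FOR (0.4).**  Scaling the amplitudes by `a` scales the mean exponent by `a`, with no `a²` term. [folklore] -/
theorem eml_oneParameter_scale (C : 𝔸) (s : ι → ℝ) (a : ℝ) (hs : ∀ i, ‖(a * s i) • C‖ < Real.log 2) :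
    eml (fun i => exp ((a * s i) • C)) = exp ((a * ∑ i, ((Fintype.card ι : ℝ))⁻¹ * s i) • C) :=
  barAvg_oneParameter_scale Finset.univ (fun _ => ((Fintype.card ι : ℝ))⁻¹) C s a fun i _ => hs i

end Summit.QuantumFields.BalabanUV.T4Continuum.NE1p.TiltedMeanOneParameter

end
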